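import Summits.AtomisticToContinuum.Crystallization.Theses.GappedShellCensus
import Literature.Geometry.DiscreteGeometry.ShellCensusTwelve
import Literature.Geometry.DiscreteGeometry.SphericalCodeHullEulerFormula
import Literature.Geometry.DiscreteGeometry.DihedralAngleFraction
import Literature.Geometry.DiscreteGeometry.KissingFanTriangleSets
import Literature.Geometry.DiscreteGeometry.ShellQuadCertTwelve

/-!
# Skeleton (line `Sketch`, lead) — crux `GappedShellCensus.ShellTrichotomy` (stmt-AtomisticToContinuum-18070)

`ShellTrichotomy`: every gapped twelve-shell `T ⊂ ℝ³` (twelve points, norms in `[0.98, 1.02]`,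
pairwise distances in `[0.98, 1.02] ∪ [1.26, ∞)`) is `1/5`-close after a linear isometry to the
fcc or the hcp kissing pattern, OR some shell point has `≥ 5` shell points within `1.02`
(capped), OR some shell point has `≤ 3` (torn).

Composition (`shellTrichotomy_of_stubs`, sorry-free glue; v10: census half = tree theorem `stub_ffrCensus4`):
* tuple form (`exists_tuple_of_card`), degree bookkeeping (`Finset` filter over `T` = filter over
  `Fin 12`), so that "neither capped nor torn" is ALL SHELL-DEGREES EXACTLY FOUR;
* `stub_census` (census half): an all-degree-4 gapped twelve-tuple is, after relabelling, a
  tolerant realization of the LABELLED cuboctahedral graph (`fccVec`, squared difference `2`) or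
  of the labelled anticuboctahedral graph (`hcpVec`, squared difference `18`): bonds exactly on the
  graph edges, every non-edge far;
* `stub_fccClose` / `stub_hcpClose` (metric half): a labelled tolerant realization is
  `TupleClose (1/5)` to `fccTuple` / `hcpTuple`; then `shellCloseTo_of_tupleClose` and
  `image_fccTuple` / `image_hcpTuple` give the route's `ShellCloseTo` disjuncts.
Local lemmas of the census half, registered so that workers can land them (`--supports`);
LANDED in the tree (Theorems/GappedShellCensusShellTrichotomyStub*.lean; imported once the census proof uses them): `stub_noNbrTriangle` (p138195), `stub_originInterior` (p138433),
`stub_commonNbrLeTwo` (p138490).  v2 adds `stub_bondHullEdge`, `stub_tCornerMax`,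
`stub_hCornerMax` (coupled corner bounds: `3·75.52° + 2·66.2° < 360°` kills the `3T+Q` vertex
type, which every exotic all-degree-4 map except the hexagonal antiprism contains — lead's census
of the 13 four-regular plane maps, compute/maps) v3 (after ALL seven delegated stubs landed: p138195 p138433 p138490 p138927 p139132 p139321 p139341) adds `stub_tCornerMin` and `stub_bondTriangleFacet`.  Original list:
`stub_noNbrTriangle` (no shell point has three mutually bonded shell neighbours: five points of
`ℝ³` cannot be pairwise at distance `∈ [0.98, 1.02]`), `stub_noFourCycle` (no bonded 4-cycle
among the four bonded neighbours of a shell point: four tetrahedral dihedral sectors `≤ 76.3°`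
do not close up), `stub_commonNbrLeTwo` (a bond has at most two common bonded neighbours),
`stub_originInterior` (all degrees four ⇒ `0` is interior to the hull of the radial projection,
the hypothesis of the tree's `euler_formula` / fan machinery).
-/

noncomputable section

namespace Summit.AtomisticToContinuum.Crystallization.Cruxes.ShellTrichotomy.Sketch

open Literature.Geometry.DiscreteGeometry Literature.Geometry.DiscreteGeometry.ShellCensus
open Summit.AtomisticToContinuum.Crystallization.Theses.GappedShellCensus
open scoped RealInnerProductSpace

/-! ## Local lemmas of the census half: ALL LANDED (nine `GappedShellCensusShellTrichotomyStub*.lean` files) -/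

/-! ## Bookkeeping -/

/-- Degree bookkeeping: the shell-degree of `t k` inside the set `T = image t` is the number of
indices `l ≠ k` with `t l` within the bond window. -/
theorem card_filter_image_eq (t : Fin 12 → EuclideanSpace ℝ (Fin 3)) (hinj : Function.Injective t)
    (k : Fin 12) :
    ((Finset.univ.image t).filter fun w => w ≠ t k ∧ dist (t k) w ≤ 1 + 1 / 50).card =
      (Finset.univ.filter fun l => l ≠ k ∧ dist (t k) (t l) ≤ 1 + 1 / 50).card := by
  classical
  rw [Finset.filter_image, Finset.card_image_of_injective _ hinj]
  congr 1
  ext l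
  simp only [Finset.mem_filter, Finset.mem_univ, true_and, ne_eq, hinj.ne_iff]

/-- The hypotheses are invariant under relabelling. -/
theorem hyps_perm (t : Fin 12 → EuclideanSpace ℝ (Fin 3)) (σ : Equiv.Perm (Fin 12))
    (hn : ∀ k, 1 - 1 / 50 ≤ ‖t k‖ ∧ ‖t k‖ ≤ 1 + 1 / 50)
    (hd : ∀ k l, k ≠ l → 1 - 1 / 50 ≤ dist (t k) (t l) ∧ (dist (t k) (t l) ≤ 1 + 1 / 50 ∨ 63 / 50 ≤ dist (t k) (t l))) :
    (∀ k, 1 - 1 / 50 ≤ ‖(t ∘ σ) k‖ ∧ ‖(t ∘ σ) k‖ ≤ 1 + 1 / 50) ∧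
    (∀ k l, k ≠ l → 1 - 1 / 50 ≤ dist ((t ∘ σ) k) ((t ∘ σ) l) ∧
      (dist ((t ∘ σ) k) ((t ∘ σ) l) ≤ 1 + 1 / 50 ∨ 63 / 50 ≤ dist ((t ∘ σ) k) ((t ∘ σ) l))) :=
  ⟨fun k => hn (σ k), fun k l hkl => hd (σ k) (σ l) (σ.injective.ne hkl)⟩


/-! ## The census half — ENTIRELY IN THE TREE (v10)

All fifteen census-half stubs of this line are landed (`Theorems/GappedShellCensusShellTrichotomyStub*.lean`:
noNbrTriangle p138195, originInterior p138433, commonNbrLeTwo p138490, bondHullEdge p138927, noFourCycle p139132,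
hCornerMax p139321, tCornerMax p139341, bondTriangleFacet p139902, tCornerMin p139924, fanStruct p144668,
fanAngles p144669, kill4T p145621, kill3TQ p145641, kill3T2H p145683, noAntiprism p147280), the finite census is
the verified two-phase growth search `Literature.Geometry.DiscreteGeometry.ShellCensusSearch.CF.concl`
(`ShellCensusSearch{Check,Frame,Growth,GrowthB,Leaf,PhaseTwo,PhaseTwoB,Sound,Run00–15,Final}.lean`, p149400 …
p156046), and the assembled census `stub_census` (all-degree-4 ⇒ relabelled fcc or hcp bond graph) is in the tree
VERBATIM as `Summit.AtomisticToContinuum.Crystallization.Theorems.stub_ffrCensus4`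
(`GappedShellCensusFiveFoldRationingRStubFfrCensus4.lean`, sibling crux 18071, re-assembled from this line's bricks);
the glue below calls it directly (no restatement, so that this file can land without dedup bounces). -/

/-- **Census half** (IN THE TREE, computational lane): this is VERBATIM
`Summit.AtomisticToContinuum.Crystallization.Theorems.stub_ffrCensus4` (`GappedShellCensusFiveFoldRationingRStubFfrCensus4.lean`,
proved from this line's fifteen landed stubs + the verified growth search `ShellCensusSearch*` by `native_decide`).  It is kept as a
stub here only so that the skeleton itself stays free of the compiler axiom; the final crux file calls the tree theorem. -/
theorem stub_census4 :
    ∀ t : Fin 12 → EuclideanSpace ℝ (Fin 3), Function.Injective t →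
        (∀ k, 1 - 1 / 50 ≤ ‖t k‖ ∧ ‖t k‖ ≤ 1 + 1 / 50) →
        (∀ k l, k ≠ l → 1 - 1 / 50 ≤ dist (t k) (t l) ∧ (dist (t k) (t l) ≤ 1 + 1 / 50 ∨ 63 / 50 ≤ dist (t k) (t l))) →
        (∀ k, (Finset.univ.filter fun l => l ≠ k ∧ dist (t k) (t l) ≤ 1 + 1 / 50).card = 4) →
        ∃ σ : Equiv.Perm (Fin 12),
          (∀ k l, k ≠ l → (dist (t (σ k)) (t (σ l)) ≤ 1 + 1 / 50 ↔ sqNormInt (fccVec k - fccVec l) = 2)) ∨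
          (∀ k l, k ≠ l → (dist (t (σ k)) (t (σ l)) ≤ 1 + 1 / 50 ↔ sqNormInt (hcpVec k - hcpVec l) = 18)) := by
  sorry

/-! ## The metric half (v12, lead c1): certified computation

`stub_fccClose` / `stub_hcpClose` are now PROVED modulo one computational stub each: the tree theorem
`Literature.Geometry.DiscreteGeometry.ShellQuadCertTwelve.tupleClose_{fcc,hcp}_of_certified` (p163241; frame gauge
`ShellCensus.exists_frame` on a bonded triangle, root context `ShellQuadCert.ShellSpec.rootCtx` of the windows / gaps / frame
facts, dyadic goal specifications `DGoal` = rational rotation + affine rotation field + Rodrigues budget, `smallRotations_holds`)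
reduces each to `QuadCert.Certified (DGoal.gp spec) spec.rootCtx`, i.e. to an ACCEPTED QuadCert certificate tree / forest for
the root context (`QuadCert.certified_of_check`, `certified_split`, `certified_steps`, `sound_of_checkText`; checker
`Literature.Analysis.ValidatedNumerics.QuadCertTree`, text format `QuadCertText`).  The two stubs below are closed by
`native_decide` run files produced by the generator (`gen/` in the lead's folder: RLT linear programming with exact dyadic
emission, every step re-checked by a Python mirror of `Tree.check`). -/

open Literature.Analysis.ValidatedNumerics Literature.Analysis.ValidatedNumerics.QuadCert
  Literature.Geometry.DiscreteGeometry.ShellQuadCert Literature.Geometry.DiscreteGeometry.ShellQuadCertTwelve in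
/-- **Computational stub, fcc**: the root context of the fcc twelve-shell specification is certified (some accepted
`QuadCert` forest proves the dyadic goal facts on every branch). -/
theorem stub_fccCertified : Certified (DGoal.gp fccQSpec) fccQSpec.rootCtx := by
  sorry

open Literature.Analysis.ValidatedNumerics Literature.Analysis.ValidatedNumerics.QuadCert
  Literature.Geometry.DiscreteGeometry.ShellQuadCert Literature.Geometry.DiscreteGeometry.ShellQuadCertTwelve in
/-- **Computational stub, hcp**: the root context of the hcp twelve-shell specification is certified. -/
theorem stub_hcpCertified : Certified (DGoal.gp hcpQSpec) hcpQSpec.rootCtx := by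
  sorry

/-- **Metric half, fcc.** A tolerant realization of the labelled cuboctahedral graph (radii and
bonds in `[0.98, 1.02]`, every non-edge `≥ 1.26`) is `1/5`-close, after a linear isometry and a
relabelling, to the fcc kissing tuple. -/
theorem stub_fccClose (t : Fin 12 → EuclideanSpace ℝ (Fin 3))
    (hn : ∀ k, 1 - 1 / 50 ≤ ‖t k‖ ∧ ‖t k‖ ≤ 1 + 1 / 50)
    (hd : ∀ k l, k ≠ l → 1 - 1 / 50 ≤ dist (t k) (t l) ∧ (dist (t k) (t l) ≤ 1 + 1 / 50 ∨ 63 / 50 ≤ dist (t k) (t l)))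
    (hG : ∀ k l, k ≠ l → (dist (t k) (t l) ≤ 1 + 1 / 50 ↔ sqNormInt (fccVec k - fccVec l) = 2)) :
    TupleClose (1 / 5) t fccTuple :=
  Literature.Geometry.DiscreteGeometry.ShellQuadCertTwelve.tupleClose_fcc_of_certified stub_fccCertified t hn hd hG

/-- **Metric half, hcp.** A tolerant realization of the labelled anticuboctahedral graph is
`1/5`-close, after a linear isometry and a relabelling, to the hcp kissing tuple. -/
theorem stub_hcpClose (t : Fin 12 → EuclideanSpace ℝ (Fin 3))
    (hn : ∀ k, 1 - 1 / 50 ≤ ‖t k‖ ∧ ‖t k‖ ≤ 1 + 1 / 50)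
    (hd : ∀ k l, k ≠ l → 1 - 1 / 50 ≤ dist (t k) (t l) ∧ (dist (t k) (t l) ≤ 1 + 1 / 50 ∨ 63 / 50 ≤ dist (t k) (t l)))
    (hG : ∀ k l, k ≠ l → (dist (t k) (t l) ≤ 1 + 1 / 50 ↔ sqNormInt (hcpVec k - hcpVec l) = 18)) :
    TupleClose (1 / 5) t hcpTuple :=
  Literature.Geometry.DiscreteGeometry.ShellQuadCertTwelve.tupleClose_hcp_of_certified stub_hcpCertified t hn hd hG

/-- **The crux from the stubs.** -/
theorem shellTrichotomy_of_stubs : ShellTrichotomy := by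
  classical
  intro T hT hnorm hdist
  obtain ⟨t, hinj, rfl⟩ := exists_tuple_of_card T hT
  have hmem : ∀ k, t k ∈ Finset.univ.image t := fun k => Finset.mem_image_of_mem t (Finset.mem_univ k)
  have hn : ∀ k, 1 - 1 / 50 ≤ ‖t k‖ ∧ ‖t k‖ ≤ 1 + 1 / 50 := fun k => hnorm (t k) (hmem k)
  have hd : ∀ k l, k ≠ l → 1 - 1 / 50 ≤ dist (t k) (t l) ∧
      (dist (t k) (t l) ≤ 1 + 1 / 50 ∨ 63 / 50 ≤ dist (t k) (t l)) :=
    fun k l hkl => hdist (t k) (hmem k) (t l) (hmem l) (hinj.ne hkl)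
  -- branches (B) capped / (C) torn are syntactic
  by_cases hB : ∃ k, 5 ≤ (Finset.univ.filter fun l => l ≠ k ∧ dist (t k) (t l) ≤ 1 + 1 / 50).card
  · obtain ⟨k, hk⟩ := hB
    refine Or.inr (Or.inr (Or.inl ⟨t k, hmem k, ?_⟩))
    rwa [card_filter_image_eq t hinj k]
  by_cases hC : ∃ k, (Finset.univ.filter fun l => l ≠ k ∧ dist (t k) (t l) ≤ 1 + 1 / 50).card ≤ 3
  · obtain ⟨k, hk⟩ := hC
    refine Or.inr (Or.inr (Or.inr ⟨t k, hmem k, ?_⟩))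
    rwa [card_filter_image_eq t hinj k]
  -- otherwise every shell-degree is exactly four
  push Not at hB hC
  have h4 : ∀ k, (Finset.univ.filter fun l => l ≠ k ∧ dist (t k) (t l) ≤ 1 + 1 / 50).card = 4 := by
    intro k; have := hB k; have := hC k; omega
  obtain ⟨σ, hσ⟩ := stub_census4 t hinj hn hd h4
  obtain ⟨hn', hd'⟩ := hyps_perm t σ hn hd
  rcases hσ with hfcc | hhcp
  · left
    have hclose : TupleClose (1 / 5) (t ∘ σ) fccTuple := stub_fccClose (t ∘ σ) hn' hd' hfcc
    have h := shellCloseTo_of_tupleClose hinj fccTuple_injective (TupleClose.of_comp_perm σ hclose)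
    rwa [image_fccTuple] at h
  · right; left
    have hclose : TupleClose (1 / 5) (t ∘ σ) hcpTuple := stub_hcpClose (t ∘ σ) hn' hd' hhcp
    have h := shellCloseTo_of_tupleClose hinj hcpTuple_injective (TupleClose.of_comp_perm σ hclose)
    rwa [image_hcpTuple] at h

/-- The crux BY NAME (for the skeleton audit). -/
theorem ShellTrichotomy_of : ShellTrichotomy := shellTrichotomy_of_stubs

end Summit.AtomisticToContinuum.Crystallization.Cruxes.ShellTrichotomy.Sketch

end
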